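import Summits.BirchSwinnertonDyer.BirchSwinnertonDyer.Theorems.AlignedTransportAtTwoMainConjectureOfRankZeroBSDAtTwoCubicDiscriminantSquareClass
import Summits.BirchSwinnertonDyer.BirchSwinnertonDyer.Theorems.AlignedTransportAtTwoMainConjectureOfRankZeroBSDAtTwoCubicFieldsAsTwoTorsionFields
import Mathlib.NumberTheory.Padics.Hensel
import HarnessLib

/-!
# Route `AlignedTransportAtTwo`, crux C2 `MainConjectureOfRankZeroBSDAtTwo` (stmt-BirchSwinnertonDyer-22298):
# `d_F ≡ disc(f) (mod ℚˣ²)` FOR EVERY GENERATING CUBIC `f` (W-free, via the universal curve `y² = f`), and a KERNEL WITNESS that the parity clause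
# of the dyadic-even named input has content: `ℚ[x]/(x³ − x − 2)` embeds into `ℚ₂` but has `v₂(d_F)` ODD; and `ℚ[x]/(x³ − x − 1)` does not embed

HONEST FRAMING. WIDTH-5 attached prover seat `bsd-line-att-p4` g34 on line `birth` of the lead `bsd-line-att-p2` (WAKE-only); `--supports`
stmt-BirchSwinnertonDyer-22298, closes nothing; BSD is NOT proved; crux C2, its verdict «blocked-on `Rank1Residual.GreenbergMuConjectureIrreducible`»
and every registered stub untouched. THEOREMS ONLY (no `def`, no named fact, no `sorry`). Sequel of this seat's `…CubicDiscriminantSquareClass`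
(`d_F = Δ_W·b²` for the cubic `2`-torsion field) read on g32's UNIVERSAL curve `W_{A,B,C} : y² = x³ + (A/4)x² + (B/16)x + C/64` (`u`-cubic `X³ + AX² + BX + C`,
`Δ = disc/256`):

* §1 ★★ `exists_discr_eq_cubicDisc_mul_sq` — **W-FREE: for every cubic number field `F ∋ e` with `e³ + Ae² + Be + C = 0` (`A, B, C ∈ ℚ`), `x³ + Ax² + Bx + C`
  without rational root and with non-square discriminant `D = A²B² − 4B³ − 4A³C − 27C² + 18ABC`: `d_F = D·b²` for a rational `b ≠ 0`** — the field
  discriminant and the discriminant of ANY generating cubic have the same square class (classically via `disc(f) = [𝓞_F : ℤ[e]]²·d_F`; here through the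
  Galois-closure square-class lemma, no integral basis needed); `even_padicValInt_discr_iff_even_padicValRat_cubicDisc` (`v_p(d_F) ≡ v_p(D) (mod 2)`).
* §2 THE WITNESS `f = x³ − x − 2` (`D = −104 = −2³·13`; the curve `y² = x³ − x − 2`, `Δ = −2⁷·13`, bad at `2`): `forall_cubic_x3_sub_x_sub_2_ne_zero` (no rational
  root: none mod `3`), `exists_padicInt_root_x3_sub_x_sub_2` (Hensel at `2`: `f(2) = 4`, `f′(2) = 11`), and for EVERY cubic number field `F ∋ e` with
  `e³ = e + 2`: ★ `nonempty_ringHom_padic_two_of_cube_eq` (`F ↪ ℚ₂`), ★ `odd_padicValInt_two_discr_of_cube_eq` (`v₂(d_F)` is ODD — `d_F = −104·b²`),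
  `not_isGalois_of_cube_eq`; ★★ `exists_dyadic_nonGalois_cubicField_odd_padicValInt_discr` — **there is a non-cyclic cubic number field that embeds into `ℚ₂`
  and has `v₂(d_F)` odd**: the dyadic-EVEN binder of `…CubicDiscriminantSquareClass` §3 quantifies over STRICTLY FEWER fields than the dyadic binder of
  `…NarrowCubicNamedInputDyadic` (such fields are the cubic `2`-torsion field of no curve with good reduction at `2`), itself strictly smaller than g33's
  all-`S₃` binder.
* §3 THE OTHER STRICT INCLUSION: `padic_two_cube_ne_add_one` (`z³ ≠ z + 1` in `ℚ₂`), `isEmpty_ringHom_padic_two_of_cube_eq_add_one`, ★★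
  `exists_nonGalois_cubicField_isEmpty_ringHom_padic_two` — **there is a non-cyclic cubic number field (that of `x³ − x − 1`, `d = −23`, `2` inert) with NO
  ring map to `ℚ₂`**: all-`S₃` (g33, v12) ⊋ dyadic (`…NarrowCubicNamedInputDyadic`) ⊋ dyadic-even (`…CubicDiscriminantSquareClass`), both inclusions
  witnessed in the kernel.

PARTITION: none; beyond-print theorem: no; BSD is NOT proved by any of this.

References: [SilvermanAEC2009] III.§1; [Marcus2018] Ch. 2 (`disc(f) = ind² · d_F`); [Cohen1993] §6.3.3, Prop. 4.4.4; [Serre1973] Ch. II §2.2 (Hensel);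
[NeukirchANT1999] Ch. II §8; tree: this seat `…CubicDiscriminantSquareClass`, `Literature/…/CubicFields/CubicFieldDiscriminantSquareClassInClosure`, g32
`…CubicFieldsAsTwoTorsionFields` (universal curve), `Rank1Residual/X5/TwoAdicImageCertificates` (`O1.forall_cubic_ne_zero_of_forall_ne`), att-p5 g14
`…AlignedTransportAtTwoBridge` (`minpoly_eq_twoDivisionUCubic`, `exists_powerBasis_gen_eq`).
-/

-- the Theorems namespace of this sub repeats the summit name by design (D-0017 nested layout)
set_option linter.dupNamespace false
set_option autoImplicit false

noncomputable section

open scoped NumberField IntermediateField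

namespace Summit.BirchSwinnertonDyer.BirchSwinnertonDyer.Theorems.AlignedTransportAtTwoCubicDiscriminantSquareClassPolynomial

open NumberField Polynomial WeierstrassCurve IntermediateField Field
  Literature.NumberTheory.EllipticCurves Literature.NumberTheory.EllipticCurves.Greenberg1999
  Literature.NumberTheory.EllipticCurves.DokchitserDokchitser2012
  Literature.NumberTheory.NumberFields Literature.NumberTheory.CubicFields
  Summit.BirchSwinnertonDyer.Rank1Residual.F1Sign2
  Summit.BirchSwinnertonDyer.BirchSwinnertonDyer.Theorems.AlignedTransportAtTwoNarrowCubicNamedInput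
  Summit.BirchSwinnertonDyer.BirchSwinnertonDyer.Theorems.AlignedTransportAtTwoNarrowCubicNamedInputDyadic
  Summit.BirchSwinnertonDyer.BirchSwinnertonDyer.Theorems.AlignedTransportAtTwoCubicDiscriminantSquareClass
  Summit.BirchSwinnertonDyer.BirchSwinnertonDyer.Theorems.AlignedTransportAtTwoCubicFieldsAsTwoTorsionFields
  Summit.BirchSwinnertonDyer.BirchSwinnertonDyer.Theorems.AlignedTransportAtTwoPointFieldCarrierCM
  Summit.BirchSwinnertonDyer.BirchSwinnertonDyer.Theorems.AlignedTransportAtTwoCMSexticFieldDoor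
  Summit.BirchSwinnertonDyer.BirchSwinnertonDyer.Theorems.AlignedTransportAtTwoSharedCubicDivisionField
  Summit.BirchSwinnertonDyer.BirchSwinnertonDyer.Theorems.AlignedTransportAtTwoBridge

/-! ## §1 `d_F ≡ disc(f) (mod ℚˣ²)` for every generating cubic `f` -/

section PolyDisc

variable (A B C : ℚ)

/-- ★★ **W-FREE: the field discriminant of a cubic field and the discriminant of ANY generating cubic have the same square class.** `F` a cubic number field,
`e ∈ F` with `e³ + Ae² + Be + C = 0`, the cubic `x³ + Ax² + Bx + C` without rational root and with `D = A²B² − 4B³ − 4A³C − 27C² + 18ABC ∉ ℚ²`: then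
`d_F = D·b²` with `b ∈ ℚ`, `b ≠ 0`. (Through the universal curve `W_{A,B,C}`, `Δ = D/256`, and `…CubicDiscriminantSquareClass.exists_discr_eq_Δ_mul_sq`.)
[cite: Marcus2018, Ch. 2 (disc(1, α, α²) = ind² · disc)] [cite: Cohen1993, Prop. 4.4.4 and §6.3.3] [cite: SilvermanAEC2009, III.§1] -/
theorem exists_discr_eq_cubicDisc_mul_sq (hirr : ∀ x : ℚ, x ^ 3 + A * x ^ 2 + B * x + C ≠ 0)
    (hD : ¬ IsSquare (A ^ 2 * B ^ 2 - 4 * B ^ 3 - 4 * A ^ 3 * C - 27 * C ^ 2 + 18 * A * B * C))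
    {F : Type} [Field F] [NumberField F] (hF : Module.finrank ℚ F = 3) {e : F}
    (he : e ^ 3 + algebraMap ℚ F A * e ^ 2 + algebraMap ℚ F B * e + algebraMap ℚ F C = 0) :
    ∃ b : ℚ, b ≠ 0 ∧ (NumberField.discr F : ℚ) = (A ^ 2 * B ^ 2 - 4 * B ^ 3 - 4 * A ^ 3 * C - 27 * C ^ 2 + 18 * A * B * C) * b ^ 2 := by
  have hD0 : A ^ 2 * B ^ 2 - 4 * B ^ 3 - 4 * A ^ 3 * C - 27 * C ^ 2 + 18 * A * B * C ≠ 0 := fun h ↦ hD ⟨0, by rw [h, mul_zero]⟩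
  haveI := isElliptic_universal A B C hD0
  have ht := not_hasRationalTwoTorsionX_universal A B C hirr
  have hsq : ¬ IsSquare (⟨0, A / 4, 0, B / 16, C / 64⟩ : WeierstrassCurve ℚ).Δ := by
    rw [Δ_universal]
    rintro ⟨r, hr⟩
    exact hD ⟨16 * r, by linear_combination (256 : ℚ) * hr⟩
  have he' := aeval_twoDivisionUCubic_universal_eq_zero A B C he
  obtain ⟨b, hb, h⟩ := exists_discr_eq_Δ_mul_sq (⟨0, A / 4, 0, B / 16, C / 64⟩ : WeierstrassCurve ℚ) ht hsq hF he'
  refine ⟨b / 16, div_ne_zero hb (by norm_num), ?_⟩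
  rw [h, Δ_universal]; ring

/-- **`v_p(d_F) ≡ v_p(D) (mod 2)` for every prime `p`** (same hypotheses; `D` the discriminant of the generating cubic). [cite: Marcus2018, Ch. 2] [cite: Cohen1993, Prop. 4.4.4] -/
theorem even_padicValInt_discr_iff_even_padicValRat_cubicDisc (hirr : ∀ x : ℚ, x ^ 3 + A * x ^ 2 + B * x + C ≠ 0)
    (hD : ¬ IsSquare (A ^ 2 * B ^ 2 - 4 * B ^ 3 - 4 * A ^ 3 * C - 27 * C ^ 2 + 18 * A * B * C))
    {F : Type} [Field F] [NumberField F] (hF : Module.finrank ℚ F = 3) {e : F}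
    (he : e ^ 3 + algebraMap ℚ F A * e ^ 2 + algebraMap ℚ F B * e + algebraMap ℚ F C = 0) (p : ℕ) [Fact p.Prime] :
    Even (padicValInt p (NumberField.discr F)) ↔
      Even (padicValRat p (A ^ 2 * B ^ 2 - 4 * B ^ 3 - 4 * A ^ 3 * C - 27 * C ^ 2 + 18 * A * B * C)) := by
  have hD0 : A ^ 2 * B ^ 2 - 4 * B ^ 3 - 4 * A ^ 3 * C - 27 * C ^ 2 + 18 * A * B * C ≠ 0 := fun h ↦ hD ⟨0, by rw [h, mul_zero]⟩
  obtain ⟨b, hb, h⟩ := exists_discr_eq_cubicDisc_mul_sq A B C hirr hD hF he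
  have hval : (padicValInt p (NumberField.discr F) : ℤ) =
      padicValRat p (A ^ 2 * B ^ 2 - 4 * B ^ 3 - 4 * A ^ 3 * C - 27 * C ^ 2 + 18 * A * B * C) + 2 * padicValRat p b := by
    rw [← padicValRat.of_int, h, padicValRat.mul hD0 (pow_ne_zero 2 hb), padicValRat.pow b]
    push_cast; ring
  have h2 : Even (2 * padicValRat p b) := even_two_mul _
  rw [← Int.even_coe_nat, hval, Int.even_add]
  exact ⟨fun hh ↦ hh.mpr h2, fun hm ↦ ⟨fun _ ↦ h2, fun _ ↦ hm⟩⟩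

end PolyDisc

/-! ## §2 The witness `x³ − x − 2`: dyadic, `v₂(d_F)` odd -/

section Witness

/-- `x³ − x − 2` has no rational root (no root modulo `3`). [cite: SilvermanAEC2009, III.2.3 (b)] -/
theorem forall_cubic_x3_sub_x_sub_2_ne_zero : ∀ x : ℚ, x ^ 3 + 0 * x ^ 2 + (-1) * x + (-2) ≠ 0 := by
  intro x hx
  refine Summit.BirchSwinnertonDyer.Rank1Residual.X5.O1.forall_cubic_ne_zero_of_forall_ne (c₂ := 0) (c₁ := -1) (c₀ := -2) (ℓ := 3)
    (by decide) x ?_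
  push_cast
  linear_combination hx

/-- `disc(x³ − x − 2) = −104` is not a square. [folklore] -/
theorem not_isSquare_disc_x3_sub_x_sub_2 :
    ¬ IsSquare ((0 : ℚ) ^ 2 * (-1) ^ 2 - 4 * (-1) ^ 3 - 4 * 0 ^ 3 * (-2) - 27 * (-2) ^ 2 + 18 * 0 * (-1) * (-2)) := by
  have h : (0 : ℚ) ^ 2 * (-1) ^ 2 - 4 * (-1) ^ 3 - 4 * 0 ^ 3 * (-2) - 27 * (-2) ^ 2 + 18 * 0 * (-1) * (-2) = -104 := by norm_num
  rw [h]
  rintro ⟨r, hr⟩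
  nlinarith [mul_self_nonneg r]

/-- **Hensel at `2`: `x³ − x − 2` has a root in `ℤ₂`** (`f(2) = 4`, `f′(2) = 11`: `|f(2)|₂ = 1/4 < 1 = |f′(2)|₂²`). [cite: Serre1973, Ch. II §2.2 (Hensel's lemma)] -/
theorem exists_padicInt_root_x3_sub_x_sub_2 : ∃ z : ℤ_[2], (z : ℚ_[2]) ^ 3 - (z : ℚ_[2]) - 2 = 0 := by
  haveI : Fact (Nat.Prime 2) := ⟨Nat.prime_two⟩
  set F : ℤ[X] := X ^ 3 - X - C 2 with hF
  have hFz : ∀ z : ℤ_[2], F.aeval z = z ^ 3 - z - ((2 : ℤ) : ℤ_[2]) := by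
    intro z
    simp only [hF, map_sub, map_pow, aeval_X, aeval_C, algebraMap_int_eq, Int.coe_castRingHom]
  have hF2 : F.aeval (2 : ℤ_[2]) = ((4 : ℤ) : ℤ_[2]) := by rw [hFz]; push_cast; norm_num
  have hdF : derivative F = C 3 * X ^ 2 - 1 := by
    simp only [hF, derivative_sub, derivative_X_pow, derivative_X, map_ofNat]
    norm_num
  have hdF2 : (derivative F).aeval (2 : ℤ_[2]) = ((11 : ℤ) : ℤ_[2]) := by
    rw [hdF]
    simp only [map_sub, map_mul, map_pow, aeval_X, aeval_C, map_one, algebraMap_int_eq, Int.coe_castRingHom]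
    push_cast; norm_num
  have hn1 : ‖(derivative F).aeval (2 : ℤ_[2])‖ = 1 := by
    rw [hdF2, PadicInt.norm_intCast_eq_one_iff]
    exact ⟨1, -5, by norm_num⟩
  have hnorm : ‖F.aeval (2 : ℤ_[2])‖ < ‖(derivative F).aeval (2 : ℤ_[2])‖ ^ 2 := by
    rw [hn1, one_pow, hF2, PadicInt.norm_int_lt_one_iff_dvd]
    norm_num
  obtain ⟨z, hz0, -, -, -⟩ := hensels_lemma hnorm
  refine ⟨z, ?_⟩
  have h := congrArg ((↑) : ℤ_[2] → ℚ_[2]) hz0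
  rw [hFz] at h
  simp only [PadicInt.coe_sub, PadicInt.coe_pow, PadicInt.coe_intCast, PadicInt.coe_zero] at h
  push_cast at h
  exact h

/-- ★ **Every cubic number field containing `e` with `e³ = e + 2` EMBEDS INTO `ℚ₂`** (`F = ℚ(e)`, `minpoly e = x³ − x − 2`, the power basis lifts `e` to the
Hensel root). [cite: NeukirchANT1999, Ch. II §8 (8.1)–(8.3)] [cite: Serre1973, Ch. II §2.2] -/
theorem nonempty_ringHom_padic_two_of_cube_eq {F : Type} [Field F] [NumberField F] (hF : Module.finrank ℚ F = 3) {e : F}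
    (he : e ^ 3 = e + 2) : Nonempty (F →+* ℚ_[2]) := by
  haveI : Fact (Nat.Prime 2) := ⟨Nat.prime_two⟩
  have hD0 : (0 : ℚ) ^ 2 * (-1) ^ 2 - 4 * (-1) ^ 3 - 4 * 0 ^ 3 * (-2) - 27 * (-2) ^ 2 + 18 * 0 * (-1) * (-2) ≠ 0 := by norm_num
  haveI := isElliptic_universal 0 (-1) (-2) hD0
  set V : WeierstrassCurve ℚ := ⟨0, (0 : ℚ) / 4, 0, (-1 : ℚ) / 16, (-2 : ℚ) / 64⟩ with hV
  have ht : ∀ x : ℚ, ¬ HasRationalTwoTorsionX V x := not_hasRationalTwoTorsionX_universal 0 (-1) (-2) forall_cubic_x3_sub_x_sub_2_ne_zero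
  have he' : aeval e (twoDivisionUCubic V) = 0 :=
    aeval_twoDivisionUCubic_universal_eq_zero 0 (-1) (-2) (by simp only [map_zero, map_neg, map_one, map_ofNat]; linear_combination he)
  obtain ⟨z, hz⟩ := exists_padicInt_root_x3_sub_x_sub_2
  have hz' : aeval (z : ℚ_[2]) (twoDivisionUCubic V) = 0 :=
    aeval_twoDivisionUCubic_universal_eq_zero 0 (-1) (-2) (F := ℚ_[2]) (by
      simp only [map_zero, map_neg, map_one, map_ofNat]
      linear_combination hz)
  have hmin : minpoly ℚ e = twoDivisionUCubic V := minpoly_eq_twoDivisionUCubic V ht he'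
  obtain ⟨pb, hgen, -⟩ := exists_powerBasis_gen_eq (natDegree_twoDivisionUCubic V) hF hmin
  have hroot : aeval (z : ℚ_[2]) (minpoly ℚ pb.gen) = 0 := by rw [hgen, hmin]; exact hz'
  exact ⟨(pb.lift (z : ℚ_[2]) hroot).toRingHom⟩

/-- ★ **Every cubic number field containing `e` with `e³ = e + 2` has `v₂(d_F)` ODD** (`d_F = −104·b²`, `−104 = −2³·13`). [cite: Marcus2018, Ch. 2] [cite: Cohen1993, Prop. 4.4.4] -/
theorem odd_padicValInt_two_discr_of_cube_eq {F : Type} [Field F] [NumberField F] (hF : Module.finrank ℚ F = 3) {e : F}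
    (he : e ^ 3 = e + 2) : Odd (padicValInt 2 (NumberField.discr F)) := by
  haveI : Fact (Nat.Prime 2) := ⟨Nat.prime_two⟩
  have he' : e ^ 3 + algebraMap ℚ F 0 * e ^ 2 + algebraMap ℚ F (-1) * e + algebraMap ℚ F (-2) = 0 := by
    simp only [map_zero, map_neg, map_one, map_ofNat]; linear_combination he
  have h := even_padicValInt_discr_iff_even_padicValRat_cubicDisc 0 (-1) (-2) forall_cubic_x3_sub_x_sub_2_ne_zero
    not_isSquare_disc_x3_sub_x_sub_2 hF he' 2
  -- `v₂(104) = 3`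
  have h104 : padicValRat 2 (104 : ℚ) = 3 := by
    rw [show (104 : ℚ) = ((104 : ℕ) : ℚ) by norm_num, padicValRat.of_nat,
      show (104 : ℕ) = 2 ^ 3 * 13 by norm_num, padicValNat.mul (by norm_num) (by norm_num), padicValNat.prime_pow,
      padicValNat.eq_zero_of_not_dvd (by norm_num)]
    norm_num
  have h104' : padicValRat 2 (-104 : ℚ) = 3 := by rw [padicValRat.neg, h104]
  have hD : (0 : ℚ) ^ 2 * (-1) ^ 2 - 4 * (-1) ^ 3 - 4 * 0 ^ 3 * (-2) - 27 * (-2) ^ 2 + 18 * 0 * (-1) * (-2) = -104 := by norm_num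
  rw [hD, h104'] at h
  rw [← Nat.not_even_iff_odd, h]
  decide

/-- **Every cubic number field containing `e` with `e³ = e + 2` is NOT Galois over `ℚ`** (`disc = −104 < 0`, an `S₃`-cubic). [cite: Cohen1993, §6.3.3]
[cite: Marcus2018, Ch. 2] -/
theorem not_isGalois_of_cube_eq {F : Type} [Field F] [NumberField F] (hF : Module.finrank ℚ F = 3) {e : F}
    (he : e ^ 3 = e + 2) : ¬ IsGalois ℚ F := by
  have hD0 : (0 : ℚ) ^ 2 * (-1) ^ 2 - 4 * (-1) ^ 3 - 4 * 0 ^ 3 * (-2) - 27 * (-2) ^ 2 + 18 * 0 * (-1) * (-2) ≠ 0 := by norm_num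
  haveI := isElliptic_universal 0 (-1) (-2) hD0
  set V : WeierstrassCurve ℚ := ⟨0, (0 : ℚ) / 4, 0, (-1 : ℚ) / 16, (-2 : ℚ) / 64⟩ with hV
  have ht : ∀ x : ℚ, ¬ HasRationalTwoTorsionX V x := not_hasRationalTwoTorsionX_universal 0 (-1) (-2) forall_cubic_x3_sub_x_sub_2_ne_zero
  have hsq : ¬ IsSquare V.Δ := by
    rw [hV, Δ_universal]
    rintro ⟨r, hr⟩
    nlinarith [mul_self_nonneg r, hr]
  have he' : aeval e (twoDivisionUCubic V) = 0 :=
    aeval_twoDivisionUCubic_universal_eq_zero 0 (-1) (-2) (by simp only [map_zero, map_neg, map_one, map_ofNat]; linear_combination he)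
  exact not_isGalois_of_root V ht hsq hF he'

/-- ★★ **THERE IS A NON-CYCLIC CUBIC NUMBER FIELD THAT EMBEDS INTO `ℚ₂` AND HAS `v₂(d_F)` ODD** (the cubic field of `x³ − x − 2`, realised as the model
`ℚ(β₀) ⊆ ℚ̄` of the `2`-torsion field of `y² = x³ − x − 2`): the dyadic-even binder quantifies over STRICTLY fewer fields than the dyadic binder; such a field is
the cubic `2`-torsion field of NO elliptic curve over `ℚ` with good reduction at `2` (`…CubicDiscriminantSquareClass.even_padicValInt_two_discr_of_hasGoodReductionAtPrime`).
[cite: Marcus2018, Ch. 2] [cite: NeukirchANT1999, Ch. II §8] [cite: Serre1973, Ch. II §2.2] -/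
theorem exists_dyadic_nonGalois_cubicField_odd_padicValInt_discr :
    ∃ (F : Type) (_ : Field F) (_ : NumberField F), Module.finrank ℚ F = 3 ∧ ¬ IsGalois ℚ F ∧
      Nonempty (F →+* ℚ_[2]) ∧ Odd (padicValInt 2 (NumberField.discr F)) := by
  have hD0 : (0 : ℚ) ^ 2 * (-1) ^ 2 - 4 * (-1) ^ 3 - 4 * 0 ^ 3 * (-2) - 27 * (-2) ^ 2 + 18 * 0 * (-1) * (-2) ≠ 0 := by norm_num
  haveI := isElliptic_universal 0 (-1) (-2) hD0
  set V : WeierstrassCurve ℚ := ⟨0, (0 : ℚ) / 4, 0, (-1 : ℚ) / 16, (-2 : ℚ) / 64⟩ with hV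
  have ht : ∀ x : ℚ, ¬ HasRationalTwoTorsionX V x := not_hasRationalTwoTorsionX_universal 0 (-1) (-2) forall_cubic_x3_sub_x_sub_2_ne_zero
  set B : IntermediateField ℚ (AlgebraicClosure ℚ) := ℚ⟮xT V two_ne_zero 0⟯ with hB
  haveI : FiniteDimensional ℚ ↥B := adjoin.finiteDimensional ((AlgebraicClosure.isAlgebraic ℚ).isAlgebraic _).isIntegral
  haveI : NumberField ↥B := NumberField.mk
  have h3 : Module.finrank ℚ ↥B = 3 := finrank_adjoin_xT_model V ht 0
  have h4mem : (4 : AlgebraicClosure ℚ) * xT V two_ne_zero 0 ∈ B := mul_mem (ofNat_mem B 4) (mem_adjoin_simple_self ℚ _)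
  have he : aeval (⟨4 * xT V two_ne_zero 0, h4mem⟩ : ↥B) (twoDivisionUCubic V) = 0 :=
    aeval_mk_eq_zero_of_aeval_eq_zero V B (aeval_four_mul_xT_twoDivisionUCubic V 0) h4mem
  have hcube : (⟨4 * xT V two_ne_zero 0, h4mem⟩ : ↥B) ^ 3 = ⟨4 * xT V two_ne_zero 0, h4mem⟩ + 2 := by
    have hc : twoDivisionUCubic V = X ^ 3 + Polynomial.C (0 : ℚ) * X ^ 2 + Polynomial.C (-1 : ℚ) * X + Polynomial.C (-2 : ℚ) :=
      twoDivisionUCubic_universal 0 (-1) (-2)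
    rw [hc] at he
    simp only [map_add, map_mul, map_pow, aeval_X, map_zero, map_neg, map_one, map_ofNat] at he
    linear_combination he
  exact ⟨↥B, inferInstance, inferInstance, h3, not_isGalois_of_cube_eq h3 hcube, nonempty_ringHom_padic_two_of_cube_eq h3 hcube,
    odd_padicValInt_two_discr_of_cube_eq h3 hcube⟩

end Witness

/-! ## §3 The other strict inclusion: `x³ − x − 1` (`d = −23`, `2` inert) is NOT dyadic -/

section Inert

/-- `t³ ≠ t + 1` in `𝔽₂` (`x³ − x − 1 ≡ x³ + x + 1` is irreducible mod `2`). [folklore] -/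
private theorem zmod_two_cube_ne_add_one : ∀ t : ZMod 2, t ^ 3 ≠ t + 1 := by decide

/-- **No `2`-adic root of `x³ − x − 1`**: for `z ∈ ℚ₂`, `z³ ≠ z + 1` (if `|z|₂ > 1` the norms differ; if `|z|₂ ≤ 1` reduce modulo `2`: `t³ − t − 1` has no root in
`𝔽₂`). Hence NO field containing such a root maps to `ℚ₂`. [cite: Serre1973, Ch. II §2.2] [cite: NeukirchANT1999, Ch. II §8 (8.2)–(8.3)] -/
theorem padic_two_cube_ne_add_one (z : ℚ_[2]) : z ^ 3 ≠ z + 1 := by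
  haveI : Fact (Nat.Prime 2) := ⟨Nat.prime_two⟩
  intro hz
  by_cases hle : ‖z‖ ≤ 1
  · -- reduce modulo `2`
    set w : ℤ_[2] := ⟨z, hle⟩ with hw
    have hw3 : w ^ 3 = w + 1 := by
      apply Subtype.ext
      simp only [hw, PadicInt.coe_pow, PadicInt.coe_add, PadicInt.coe_one]
      exact hz
    have h2 := congrArg (PadicInt.toZMod (p := 2)) hw3
    rw [map_pow, map_add, map_one] at h2
    exact zmod_two_cube_ne_add_one _ h2
  · -- `|z|₂ > 1`: `|z³| = |z|³ > |z| ≥ |z + 1|`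
    have hgt : 1 < ‖z‖ := not_le.mp hle
    have h1 : ‖z + 1‖ ≤ ‖z‖ := by
      calc ‖z + 1‖ ≤ max ‖z‖ ‖(1 : ℚ_[2])‖ := Padic.nonarchimedean z 1
        _ = ‖z‖ := by rw [norm_one]; exact max_eq_left hgt.le
    have h3 : ‖z ^ 3‖ = ‖z‖ ^ 3 := norm_pow z 3
    rw [hz] at h3
    have hle3 : ‖z‖ ^ 3 ≤ ‖z‖ := h3 ▸ h1
    exact absurd hle3 (not_le.mpr (lt_self_pow₀ hgt (by norm_num)))

/-- **A field containing `e` with `e³ = e + 1` admits NO ring map to `ℚ₂`** (W-free; e.g. the cubic field of discriminant `−23`, in which `2` is inert).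
[cite: NeukirchANT1999, Ch. II §8 (8.2)–(8.3)] -/
theorem isEmpty_ringHom_padic_two_of_cube_eq_add_one {F : Type} [Field F] {e : F} (he : e ^ 3 = e + 1) :
    IsEmpty (F →+* ℚ_[2]) :=
  ⟨fun φ ↦ padic_two_cube_ne_add_one (φ e) (by rw [← map_pow, he, map_add, map_one])⟩

/-- `x³ − x − 1` has no rational root (no root modulo `2`). [cite: SilvermanAEC2009, III.2.3 (b)] -/
theorem forall_cubic_x3_sub_x_sub_1_ne_zero : ∀ x : ℚ, x ^ 3 + 0 * x ^ 2 + (-1) * x + (-1) ≠ 0 := by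
  intro x hx
  refine Summit.BirchSwinnertonDyer.Rank1Residual.X5.O1.forall_cubic_ne_zero_of_forall_ne (c₂ := 0) (c₁ := -1) (c₀ := -1) (ℓ := 2)
    (by decide) x ?_
  push_cast
  linear_combination hx

/-- ★★ **THERE IS A NON-CYCLIC CUBIC NUMBER FIELD THAT DOES NOT EMBED INTO `ℚ₂`** (the cubic field of `x³ − x − 1`, discriminant `−23`, `2` inert; realised as
the model `ℚ(β₀)` of the `2`-torsion field of `y² = x³ − x − 1`): g33's all-`S₃` binder quantifies over STRICTLY more fields than the dyadic binder.
[cite: NeukirchANT1999, Ch. II §8] [cite: Cohen1993, §6.3.3] -/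
theorem exists_nonGalois_cubicField_isEmpty_ringHom_padic_two :
    ∃ (F : Type) (_ : Field F) (_ : NumberField F), Module.finrank ℚ F = 3 ∧ ¬ IsGalois ℚ F ∧ IsEmpty (F →+* ℚ_[2]) := by
  have hD0 : (0 : ℚ) ^ 2 * (-1) ^ 2 - 4 * (-1) ^ 3 - 4 * 0 ^ 3 * (-1) - 27 * (-1) ^ 2 + 18 * 0 * (-1) * (-1) ≠ 0 := by norm_num
  haveI := isElliptic_universal 0 (-1) (-1) hD0
  set V : WeierstrassCurve ℚ := ⟨0, (0 : ℚ) / 4, 0, (-1 : ℚ) / 16, (-1 : ℚ) / 64⟩ with hV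
  have ht : ∀ x : ℚ, ¬ HasRationalTwoTorsionX V x := not_hasRationalTwoTorsionX_universal 0 (-1) (-1) forall_cubic_x3_sub_x_sub_1_ne_zero
  have hsq : ¬ IsSquare V.Δ := by
    rw [hV, Δ_universal]
    rintro ⟨r, hr⟩
    nlinarith [mul_self_nonneg r, hr]
  set B : IntermediateField ℚ (AlgebraicClosure ℚ) := ℚ⟮xT V two_ne_zero 0⟯ with hB
  haveI : FiniteDimensional ℚ ↥B := adjoin.finiteDimensional ((AlgebraicClosure.isAlgebraic ℚ).isAlgebraic _).isIntegral
  haveI : NumberField ↥B := NumberField.mk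
  have h3 : Module.finrank ℚ ↥B = 3 := finrank_adjoin_xT_model V ht 0
  have h4mem : (4 : AlgebraicClosure ℚ) * xT V two_ne_zero 0 ∈ B := mul_mem (ofNat_mem B 4) (mem_adjoin_simple_self ℚ _)
  have he : aeval (⟨4 * xT V two_ne_zero 0, h4mem⟩ : ↥B) (twoDivisionUCubic V) = 0 :=
    aeval_mk_eq_zero_of_aeval_eq_zero V B (aeval_four_mul_xT_twoDivisionUCubic V 0) h4mem
  have hcube : (⟨4 * xT V two_ne_zero 0, h4mem⟩ : ↥B) ^ 3 = ⟨4 * xT V two_ne_zero 0, h4mem⟩ + 1 := by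
    have hc : twoDivisionUCubic V = X ^ 3 + Polynomial.C (0 : ℚ) * X ^ 2 + Polynomial.C (-1 : ℚ) * X + Polynomial.C (-1 : ℚ) :=
      twoDivisionUCubic_universal 0 (-1) (-1)
    have he' := he
    rw [hc] at he'
    simp only [map_add, map_mul, map_pow, aeval_X, map_zero, map_neg, map_one] at he'
    linear_combination he'
  exact ⟨↥B, inferInstance, inferInstance, h3, not_isGalois_of_root V ht hsq h3 he, isEmpty_ringHom_padic_two_of_cube_eq_add_one hcube⟩

end Inert

end Summit.BirchSwinnertonDyer.BirchSwinnertonDyer.Theorems.AlignedTransportAtTwoCubicDiscriminantSquareClassPolynomial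

end
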